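import Summits.BirchSwinnertonDyer.BirchSwinnertonDyer.Theses.TameQuarticManinParity
import HarnessLib

/-!
# Route `TameQuarticManinParity`, LINE 24 (bsd-idea-3 g8), glue G24 `TprimeIrrTwistLatticeOrientationOfDichotomy`
# (stmt-BirchSwinnertonDyer-22546) — PROVED BY NAME

Cell `pub/bsd-wall`, D-0145 line `route-BirchSwinnertonDyer-TeichmullerTwistDescent`, seat `bsd-line-ttd-p1` g10,
working the planner-of-record's TQMP LINE 24. BSD is NOT proved by this; Manin's conjecture is not proved by this; the
dichotomy D24 (`TprimeIrrTwistLatticeDichotomy`, stmt-22544) and N24 (`TprimeIrrKodairaThreeNoReverseTwistInclusion`,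
stmt-22545) stay OPEN, and so does the orientation O22 (`TprimeIrrTwistLatticeOrientation`, stmt-28139). This file
closes ONLY the glue: O22 ⟸ D24 ∧ N24.

## Statement (verbatim the route decl)

`TprimeIrrTwistLatticeDichotomy → TprimeIrrKodairaThreeNoReverseTwistInclusion → TprimeIrrTwistLatticeOrientation`.

## Proof

On a Kodaira-III row the dichotomy gives `Λ(D.f) ⊆ g(χ)·Λ(D.f ⊗ χ)` or the reverse inclusion, and N24 excludes the
reverse inclusion. Design: theorems only; no definition, no named fact, no `sorry`; axioms `propext`, `Classical.choice`,
`Quot.sound`.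
-/

set_option autoImplicit false
-- D-0017: single-problem summit, so `Summit.BirchSwinnertonDyer.BirchSwinnertonDyer.…` repeats a namespace BY DESIGN.
set_option linter.dupNamespace false

namespace Summit.BirchSwinnertonDyer.BirchSwinnertonDyer.Theorems.TameQuarticManinParity

open Summit.BirchSwinnertonDyer.BirchSwinnertonDyer.Theses.TameQuarticManinParity

/-- **Glue G24** (stmt-BirchSwinnertonDyer-22546), by name: D24 (twist-lattice dichotomy on the irreducible (t′) rows)
∧ N24 (no reverse inclusion on the Kodaira-III rows) ⟹ O22 `TprimeIrrTwistLatticeOrientation`. Pure logic. -/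
theorem tprimeIrrTwistLatticeOrientationOfDichotomy_proof : TprimeIrrTwistLatticeOrientationOfDichotomy := by
  unfold TprimeIrrTwistLatticeOrientationOfDichotomy
  intro hD hN W _ _ _ hcm hadd ht hirr h3 D h9 χ hχ hprim z hz
  rcases hD W hcm hadd ht hirr D h9 χ hχ hprim with h | h
  · exact h z hz
  · exact absurd h (hN W hcm hadd ht hirr h3 D h9 χ hχ hprim)

end Summit.BirchSwinnertonDyer.BirchSwinnertonDyer.Theorems.TameQuarticManinParity
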